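import Literature.AnabelianGeometry.EtaleTheta.SettingModelChiNoCommAxisCusp
import Literature.AnabelianGeometry.EtaleTheta.SettingModelTateSemidirect
import HarnessLib

/-!
# The Tate-sheared carriers `Γ ⋊_{actχq} G_{ℚ_p}` (the `IsTateOrigin` models `modelχq p i j`, ALL `i, j`) admit NO cusp
# datum with inertia on the standard commutator axis

Mochizuki, *The étale theta function …*, Publ. RIMS **45** (2009) [EtTh], §1 p. 13 (cusps, `D_x ↠ G_K`, `I_x ≅ Ẑ(1)`),
Prop. 1.5 (iii) p. 23 (the affine action). Cell abc-iut, layer L2 (NV lane), seat abc-iut-w5-d165 (gen 4); PROOF-ONLY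
(0 definitions). Sequel of this seat's `SettingModelChiTwistCuspObstruction` (p447070) / `SettingModelChiNoCommAxisCusp`
(p447503) for abc-iut-L2-t5/t6's three-parameter affine action `actHatχq p i j σ = Inn(b^{κ^i}) ∘ shear(κ^j) ∘ θ_χ`
(`SettingModelTateSemidirect`, `SettingModelChiShearInner`), the `Δ`-action of abc-iut-w5-d051's stage-2 models
`modelχq p i j` — among them the ONLY `IsTateOrigin` inhabitants of the zoo (`|j| = 2`, p443184):

* §1 `prop_right_of_conj_commAxis_mem` — the §6 carrier lemma of p447070 for an ARBITRARY intertwined family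
  `Φ : G → Aut(F̂₂)` (`gfpFst (ψ σ q) = Φ σ (gfpFst q)`): whatever follows from «`Φ σ (η c)` is `F̂₂`-conjugate into
  `c^Ẑ`» follows for `d.right` from «`d` conjugates the generator of `inl(g₀ c^Ẑ g₀⁻¹)` back into it»;
* §2 `actHatχq_eta_cElt` — `actHatχq σ (η c) = b^m ⁅η a · b^k, b^{χ σ}⁆ b^{−m}`; hence (`isConj_shearComm_of_isConj_actHatχq`)
  conjugacy into the axis forces `χ σ = ±1` (this seat's `eq_one_or_eq_negOneAut_of_isConj_shearComm`);
* §3 **`actχq_not_exists_normalizer_commAxis_onto`** — in `Γ ⋊_{actχq p i j} G_{ℚ_p}` (every `i j`) no subgroup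
  normalising a conjugate standard commutator-axis inertia surjects onto `G_{ℚ_p}`: NO `TemperedCurve` structure on the
  Tate-sheared carrier — in particular on the `IsTateOrigin` models `modelχq p i (±2)` — has a cusp with standard
  commutator-axis inertia.

HONEST CAVEAT (as in p447954): «standard» = the axis `⟨[a,b]⟩⁻` of the models' distinguished generating pair and its
`Γ`-conjugates; an exotic procyclic axis `β(c)^Ẑ` (`β ∈ Aut(F̂₂)` outside `⟨Inn, θ, shear⟩`) is not excluded here.
SEMI-SYNTHETIC carriers = consistency evidence only; no side taken on [IUTchIII] Cor. 3.12; typed ≠ proved.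
-/

noncomputable section

namespace Literature.AnabelianGeometry.EtaleTheta.SettingModel

open Literature.AnabelianGeometry.SemiGraphs
open Literature.AnabelianGeometry.AbsoluteAnabelian
open CategoryTheory Function
open scoped commutatorElement Pointwise

/-! ## §1. The carrier lemma for an arbitrary intertwined family of automorphisms of `F̂₂` -/

section Generic

variable {G : Type*} [Group G] (ψ : G →* MulAut Gfp) (Φ : G → MulAut F₂hatT)

/-- **Generic carrier lemma.** In `Γ ⋊_ψ G` with `gfpFst ∘ ψ σ = Φ σ ∘ gfpFst`, if `d` conjugates the generator
`inl(g₀ c g₀⁻¹)` of a conjugate standard commutator axis into `inl(g₀ c^Ẑ g₀⁻¹)`, then `Φ(d.right)(η c)` is `F̂₂`-conjugate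
to an element of `c^Ẑ`. [cite: MochizukiEtTh2009, §1 p.13] -/
theorem exists_isConj_of_conj_commAxis_mem (hψ : ∀ (σ : G) (q : Gfp), gfpFst (ψ σ q) = Φ σ (gfpFst q))
    (g₀ : Gfp) (d : Gfp ⋊[ψ] G)
    (hd : d * SemidirectProduct.inl (g₀ * cPowGfp (iotaZ (Multiplicative.ofAdd 1)) * g₀⁻¹) * d⁻¹ ∈
      ((cAxisGfp.map (MulAut.conj g₀).toMonoidHom).map (SemidirectProduct.inl : Gfp →* Gfp ⋊[ψ] G))) :
    ∃ x ∈ cAxis, IsConj (Φ d.right (eta cElt)) x := by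
  obtain ⟨z', hz', hz⟩ := hd
  obtain ⟨z, hz0, rfl⟩ := hz'
  rw [← SemidirectProduct.inl_left_mul_inr_right d, semidirect_conj_inl ψ] at hz
  have hz2 := SemidirectProduct.inl_injective hz
  have e := congrArg gfpFst hz2
  have hzax : gfpFst z ∈ cAxis := by
    rw [← map_gfpFst_cAxisGfp]; exact Subgroup.mem_map_of_mem _ hz0
  refine ⟨gfpFst z, hzax, isConj_iff.mpr ⟨(gfpFst g₀)⁻¹ * gfpFst d.left * Φ d.right (gfpFst g₀), ?_⟩⟩
  have hZ : gfpFst z = (gfpFst g₀)⁻¹ *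
      gfpFst (d.left * (ψ d.right) (g₀ * cPowGfp (iotaZ (Multiplicative.ofAdd 1)) * g₀⁻¹) * d.left⁻¹) *
        gfpFst g₀ := by
    rw [← e]
    change gfpFst z = (gfpFst g₀)⁻¹ * gfpFst (g₀ * z * g₀⁻¹) * gfpFst g₀
    rw [map_mul, map_mul, map_inv]
    group
  rw [hZ]
  simp only [map_mul, map_inv, hψ, gfpFst_cPowGfp, cPow_spec]
  group

/-- Hence: any property of `σ` implied by «`Φ σ (η c)` conjugate into `c^Ẑ`» holds for `d.right`, and for EVERY `σ` as
soon as a subgroup normalising the inertia surjects onto `G`. [cite: MochizukiEtTh2009, §1 p.13] -/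
theorem forall_prop_of_le_normalizer_commAxis (hψ : ∀ (σ : G) (q : Gfp), gfpFst (ψ σ q) = Φ σ (gfpFst q))
    (P : G → Prop) (hP : ∀ σ : G, ∀ x ∈ cAxis, IsConj (Φ σ (eta cElt)) x → P σ)
    (g₀ : Gfp) (D : Subgroup (Gfp ⋊[ψ] G))
    (hD : D ≤ Subgroup.normalizer ((((cAxisGfp.map (MulAut.conj g₀).toMonoidHom).map
      (SemidirectProduct.inl : Gfp →* Gfp ⋊[ψ] G)) : Subgroup (Gfp ⋊[ψ] G)) : Set (Gfp ⋊[ψ] G)))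
    (hsurj : ∀ σ : G, ∃ d ∈ D, d.right = σ) (σ : G) : P σ := by
  obtain ⟨d, hdD, rfl⟩ := hsurj σ
  have hc : cPowGfp (iotaZ (Multiplicative.ofAdd 1)) ∈ cAxisGfp := ⟨_, rfl⟩
  have hmem : (SemidirectProduct.inl (g₀ * cPowGfp (iotaZ (Multiplicative.ofAdd 1)) * g₀⁻¹) : Gfp ⋊[ψ] G) ∈
      ((cAxisGfp.map (MulAut.conj g₀).toMonoidHom).map (SemidirectProduct.inl : Gfp →* Gfp ⋊[ψ] G)) :=
    Subgroup.mem_map_of_mem _ (Subgroup.mem_map_of_mem (MulAut.conj g₀).toMonoidHom hc)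
  obtain ⟨x, hx, hcx⟩ := exists_isConj_of_conj_commAxis_mem ψ Φ hψ g₀ d
    ((Subgroup.mem_normalizer_iff.mp (hD hdD) _).mp hmem)
  exact hP _ x hx hcx

end Generic

/-! ## §2. The affine action on the cusp commutator -/

section Affine

variable (p : ℕ) [hp : Fact p.Prime] (i j : ℤ)

/-- **`actHatχq σ (η c) = b^m · ⁅η a · b^k, b^{χ(σ)(1)}⁆ · b^{−m}`** (`m = κ^i`, `k = κ^j`): inner part and shear do not
change the conjugacy class of the twisted commutator. [cite: MochizukiEtTh2009, Prop 1.5 (iii) p.23] -/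
theorem actHatχq_eta_cElt (σ : GQp p) :
    actHatχq p i j σ (eta cElt) = bPow (kappaP p σ ^ i) *
      ⁅eta (FreeGroup.of 0) * bPow (kappaP p σ ^ j), bPow (chi p σ (iotaZ (Multiplicative.ofAdd 1)))⁆ *
        (bPow (kappaP p σ ^ i))⁻¹ := by
  rw [actHatχq_apply, affTwist₃_apply, innB_apply, eta_cElt_eq, map_commutatorElement, map_commutatorElement,
    twist_eta_of_zero, twist_eta_of_one, shear_eta_of_zero, shear_bPow]

/-- Conjugacy of `actHatχq σ (η c)` into the axis is conjugacy of the sheared commutator into the axis.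
[cite: MochizukiEtTh2009, Prop 1.5 (iii) p.23] -/
theorem isConj_shearComm_of_isConj_actHatχq (σ : GQp p) {x : F₂hatT}
    (h : IsConj (actHatχq p i j σ (eta cElt)) x) :
    IsConj ⁅eta (FreeGroup.of 0) * bPow (kappaP p σ ^ j), bPow (chi p σ (iotaZ (Multiplicative.ofAdd 1)))⁆ x := by
  rw [actHatχq_eta_cElt] at h
  exact (isConj_iff.mpr ⟨bPow (kappaP p σ ^ i), rfl⟩).trans h

/-- **At the affine carrier: conjugating the standard axis back into itself forces `χ(σ) = ±1`.**
[cite: MochizukiEtTh2009, §1 p.13] -/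
theorem chi_eq_of_isConj_actHatχq (σ : GQp p) {x : F₂hatT} (hx : x ∈ cAxis)
    (h : IsConj (actHatχq p i j σ (eta cElt)) x) : chi p σ = 1 ∨ chi p σ = ZHatLevel.negOneAut :=
  eq_one_or_eq_negOneAut_of_isConj_shearComm (chi p σ) _ hx (isConj_shearComm_of_isConj_actHatχq p i j σ h)

/-! ## §3. No Galois-surjective normaliser of a standard commutator-axis inertia in `Γ ⋊_{actχq} G_{ℚ_p}` -/

/-- **The Tate-sheared carrier `Γ ⋊_{actχq p i j} G_{ℚ_p}` (every `i, j`; the carrier of the `IsTateOrigin` models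
`modelχq p i (±2)`) has NO subgroup normalising a conjugate standard commutator-axis inertia `inl(g₀ c^Ẑ g₀⁻¹)` and
surjecting onto `G_{ℚ_p}`** — so no `TemperedCurve` structure on it has a cusp with standard commutator-axis inertia.
[cite: MochizukiEtTh2009, §1 p.13] -/
theorem actχq_not_exists_normalizer_commAxis_onto (g₀ : Gfp) :
    ¬ ∃ D : Subgroup (Gfp ⋊[actχq p i j] GQp p), D ≤ Subgroup.normalizer
      ((((cAxisGfp.map (MulAut.conj g₀).toMonoidHom).map
        (SemidirectProduct.inl : Gfp →* Gfp ⋊[actχq p i j] GQp p)) : Subgroup (Gfp ⋊[actχq p i j] GQp p)) :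
          Set (Gfp ⋊[actχq p i j] GQp p)) ∧ ∀ σ : GQp p, ∃ d ∈ D, d.right = σ := by
  rintro ⟨D, hD, hsurj⟩
  obtain ⟨σ₀, h1, h2⟩ := exists_chi_ne_one_ne_negOneAut p
  rcases forall_prop_of_le_normalizer_commAxis (actχq p i j) (fun σ => actHatχq p i j σ) (fun σ q => rfl)
      (fun σ => chi p σ = 1 ∨ chi p σ = ZHatLevel.negOneAut)
      (fun σ x hx h => chi_eq_of_isConj_actHatχq p i j σ hx h) g₀ D hD hsurj σ₀ with h | h
  · exact h1 h
  · exact h2 h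

/-- Positively phrased: every subgroup of `Γ ⋊_{actχq} G_{ℚ_p}` normalising a conjugate standard commutator-axis inertia
MISSES some fibre of `aug`. [cite: MochizukiEtTh2009, §1 p.13] -/
theorem actχq_exists_right_ne_of_le_normalizer_commAxis (g₀ : Gfp) (D : Subgroup (Gfp ⋊[actχq p i j] GQp p))
    (hD : D ≤ Subgroup.normalizer ((((cAxisGfp.map (MulAut.conj g₀).toMonoidHom).map
      (SemidirectProduct.inl : Gfp →* Gfp ⋊[actχq p i j] GQp p)) : Subgroup (Gfp ⋊[actχq p i j] GQp p)) :
        Set (Gfp ⋊[actχq p i j] GQp p))) :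
    ∃ σ : GQp p, ∀ d ∈ D, d.right ≠ σ := by
  by_contra h
  simp only [not_exists, not_forall, not_not] at h
  exact actχq_not_exists_normalizer_commAxis_onto p i j g₀
    ⟨D, hD, fun σ => (h σ).imp fun d hd => ⟨hd.1, hd.2⟩⟩

end Affine

end Literature.AnabelianGeometry.EtaleTheta.SettingModel

end
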